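import Literature.Computability.MetaComplexity.EFNetlist
import HarnessLib

/-!
# Propositional bookkeeping for extended Frege proof construction: contexts, cases, bits

Small sound rules and blocks for the logical glue between the arithmetic laws of the `EF`
proof kit (`EFScaffold.lean`, `EFNetlist.lean`): case analysis on a bit by extending the
context (`K` becomes `K ∨ ¬A`, resp. `K ∨ A`, the case hypothesis being available as
`(K ∨ ¬A) ∨ A`), weakening available lines into an extended context, merging the two cases,
ex falso, and the algebra of bit equalities (`↔` symmetric/transitive, transport of truth
values, constants, multiplexer and mask gates under a known selector).

## Content

* `Logic.rules` with `Logic.isSound_of_mem_rules` (truth tables).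
* `Logic.weakLines` / `Logic.isBlock_weakLines`: a list of available lines re-derived under an
  extended context.
* `Logic.isBlock_cases`: the case-split combinator — blocks deriving `(K ∨ ¬A) ∨ Lᵢ` and
  `(K ∨ A) ∨ Lᵢ` followed by the merged lines `K ∨ Lᵢ`.

## Sources

* S. A. Cook, R. A. Reckhow, *The relative efficiency of propositional proof systems*,
  J. Symbolic Logic 44 (1979), §2 (sound schematic rules; the deduction theorem is replaced
  here by explicit contexts, cf. J. Krajíček, *Bounded Arithmetic, Propositional Logic, and
  Complexity Theory* (1995), Lemma 4.4.10).
-/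

namespace Literature.Computability.MetaComplexity

open _root_.Computability Complexity Complexity.PropForm Netlist

namespace Logic

/-! ### Rules -/

/-- Weakening into an extended context: `K ∨ L ⊢ (K ∨ A) ∨ L`. [cite: CookReckhow1979, §2 (sound rule)] -/
def rWeakCtx : FregeRule := ⟨[disj (var 0) (var 1)], disj (disj (var 0) (var 2)) (var 1)⟩
/-- The case hypothesis, positive: `⊢ (K ∨ ¬A) ∨ A`. [cite: CookReckhow1979, §2 (sound rule)] -/
def rCaseT : FregeRule := ⟨[], disj (disj (var 0) (neg (var 1))) (var 1)⟩
/-- The case hypothesis, negative: `⊢ (K ∨ A) ∨ ¬A`. [cite: CookReckhow1979, §2 (sound rule)] -/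
def rCaseF : FregeRule := ⟨[], disj (disj (var 0) (var 1)) (neg (var 1))⟩
/-- Merging the cases: `(K ∨ ¬A) ∨ L, (K ∨ A) ∨ L ⊢ K ∨ L`. [cite: CookReckhow1979, §2 (sound rule)] -/
def rMerge : FregeRule :=
  ⟨[disj (disj (var 0) (neg (var 1))) (var 2), disj (disj (var 0) (var 1)) (var 2)], disj (var 0) (var 2)⟩
/-- Ex falso: `K ∨ A, K ∨ ¬A ⊢ K ∨ L`. [cite: CookReckhow1979, §2 (sound rule)] -/
def rExFalso : FregeRule := ⟨[disj (var 0) (var 1), disj (var 0) (neg (var 1))], disj (var 0) (var 2)⟩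
/-- Symmetry of bit equality. [cite: CookReckhow1979, §2 (sound rule)] -/
def rEqvSymm : FregeRule := ⟨[ctx (var 0) (eqv 1 2)], ctx (var 0) (eqv 2 1)⟩
/-- Transitivity of bit equality. [cite: CookReckhow1979, §2 (sound rule)] -/
def rEqvTrans : FregeRule := ⟨[ctx (var 0) (eqv 1 2), ctx (var 0) (eqv 2 3)], ctx (var 0) (eqv 1 3)⟩
/-- Transport of truth along a bit equality. [cite: CookReckhow1979, §2 (sound rule)] -/
def rEqvTrue : FregeRule := ⟨[ctx (var 0) (var 1), ctx (var 0) (eqv 1 2)], ctx (var 0) (var 2)⟩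
/-- Transport of falsity along a bit equality. [cite: CookReckhow1979, §2 (sound rule)] -/
def rEqvFalse : FregeRule := ⟨[ctx (var 0) (neg (var 1)), ctx (var 0) (eqv 1 2)], ctx (var 0) (neg (var 2))⟩
/-- Two true bits are equal. [cite: CookReckhow1979, §2 (sound rule)] -/
def rEqvOfTrue : FregeRule := ⟨[ctx (var 0) (var 1), ctx (var 0) (var 2)], ctx (var 0) (eqv 1 2)⟩
/-- Two false bits are equal. [cite: CookReckhow1979, §2 (sound rule)] -/
def rEqvOfFalse : FregeRule := ⟨[ctx (var 0) (neg (var 1)), ctx (var 0) (neg (var 2))], ctx (var 0) (eqv 1 2)⟩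
/-- A gate defined as `⊥` is false. [cite: CookReckhow1979, §2 (sound rule)] -/
def rCstF : FregeRule := ⟨[ctx (var 0) (biimp (var 1) (const false))], ctx (var 0) (neg (var 1))⟩
/-- A gate defined as `⊤` is true. [cite: CookReckhow1979, §2 (sound rule)] -/
def rCstT : FregeRule := ⟨[ctx (var 0) (biimp (var 1) (const true))], ctx (var 0) (var 1)⟩
/-- A multiplexer with true selector returns its first data input. [cite: CookReckhow1979, §2 (sound rule)] -/
def rMuxT : FregeRule :=
  ⟨[ctx (var 0) (biimp (var 1) (muxF (var 2) (var 3) (var 4))), ctx (var 0) (var 2)], ctx (var 0) (eqv 1 3)⟩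
/-- A multiplexer with false selector returns its second data input. [cite: CookReckhow1979, §2 (sound rule)] -/
def rMuxF : FregeRule :=
  ⟨[ctx (var 0) (biimp (var 1) (muxF (var 2) (var 3) (var 4))), ctx (var 0) (neg (var 2))], ctx (var 0) (eqv 1 4)⟩
/-- A mask gate `m = g ∧ x` with `g` true equals `x`. [cite: CookReckhow1979, §2 (sound rule)] -/
def rAndT : FregeRule :=
  ⟨[ctx (var 0) (biimp (var 1) (conj (var 2) (var 3))), ctx (var 0) (var 2)], ctx (var 0) (eqv 1 3)⟩
/-- A mask gate `m = g ∧ x` with `g` false is false. [cite: CookReckhow1979, §2 (sound rule)] -/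
def rAndF : FregeRule :=
  ⟨[ctx (var 0) (biimp (var 1) (conj (var 2) (var 3))), ctx (var 0) (neg (var 2))], ctx (var 0) (neg (var 1))⟩
/-- A complement gate `n = ¬y` transports: `n ↔ n'` from `y ↔ y'` and both definitions.
[cite: CookReckhow1979, §2 (sound rule)] -/
def rNotLeib : FregeRule :=
  ⟨[ctx (var 0) (biimp (var 1) (neg (var 2))), ctx (var 0) (biimp (var 3) (neg (var 4))), ctx (var 0) (eqv 2 4)],
   ctx (var 0) (eqv 1 3)⟩
/-- From a bit and the negation of an equal bit, falsity: `K ∨ a, K ∨ ¬b, K ∨ (a ↔ b) ⊢ K ∨ ⊥`.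
[cite: CookReckhow1979, §2 (sound rule)] -/
def rClash : FregeRule :=
  ⟨[ctx (var 0) (var 1), ctx (var 0) (neg (var 2)), ctx (var 0) (eqv 1 2)], ctx (var 0) (const false)⟩

/-- The rules of the logic layer. [cite: CookReckhow1979, §2] -/
def rules : List FregeRule :=
  [rWeakCtx, rCaseT, rCaseF, rMerge, rExFalso, rEqvSymm, rEqvTrans, rEqvTrue, rEqvFalse, rEqvOfTrue,
    rEqvOfFalse, rCstF, rCstT, rMuxT, rMuxF, rAndT, rAndF, rNotLeib, rClash]

/-- Every rule of the logic layer is sound (truth tables). [cite: CookReckhow1979, §2 (sound rule)] -/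
theorem isSound_of_mem_rules : ∀ r ∈ rules, r.IsSound := by
  intro r hr
  simp only [rules, List.mem_cons, List.not_mem_nil, or_false] at hr
  rcases hr with rfl | rfl | rfl | rfl | rfl | rfl | rfl | rfl | rfl | rfl | rfl | rfl | rfl | rfl | rfl |
    rfl | rfl | rfl | rfl <;> exact FregeRule.isSound_of_check (by decide +kernel)

/-- Membership in `rules`, by position. [folklore] -/
theorem mem_rules_of_getElem {i : ℕ} (hi : i < rules.length) : rules[i] ∈ rules := List.getElem_mem hi

variable {G : FregeSystem} {Γ : Set (PropForm ℕ)}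

/-- One inference by the `i`-th logic rule (explicit conclusion, premises to be found).
[cite: CookReckhow1979, §2] -/
theorem infer (hG : ∀ r ∈ rules, r ∈ G.rules) (i : ℕ) (hi : i < rules.length) {S : Set (PropForm ℕ)}
    (σ : ℕ → PropForm ℕ) {θ : PropForm ℕ} (hθ : (rules[i]).conclusion.subst σ = θ)
    (hp : ∀ p ∈ (rules[i]).premises, p.subst σ ∈ S) : G.IsInferredFrom S θ :=
  FregeSystem.IsInferredFrom.of_rule (hG _ (List.getElem_mem hi)) σ hθ hp

/-! ### Weakening into an extended context -/

/-- The lines `(K ∨ A) ∨ L` for `L ∈ Ls`. [folklore] -/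
def weakLines (K A : PropForm ℕ) (Ls : List (PropForm ℕ)) : List (PropForm ℕ) :=
  Ls.map fun L => ctx (disj K A) L

/-- **Weakening block**: available lines `K ∨ L` are re-derived under the extended context
`K ∨ A`. [cite: CookReckhow1979, §2] -/
theorem isBlock_weakLines (hG : ∀ r ∈ rules, r ∈ G.rules) (K A : PropForm ℕ) {Ls : List (PropForm ℕ)}
    (h : ∀ L ∈ Ls, ctx K L ∈ Γ) : G.IsBlock Γ (weakLines K A Ls) :=
  Scaffold.isBlock_of_forall fun θ hθ => by
    obtain ⟨L, hL, rfl⟩ := List.mem_map.1 hθ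
    exact Or.inr (infer hG 0 (by decide) (FregeSystem.sub [K, L, A]) rfl
      (FregeSystem.prems_cons (h L hL) FregeSystem.prems_nil))

/-- The weakened line of a listed `L`. [folklore] -/
theorem mem_weakLines {K A L : PropForm ℕ} {Ls : List (PropForm ℕ)} (hL : L ∈ Ls) :
    ctx (disj K A) L ∈ weakLines K A Ls :=
  List.mem_map.2 ⟨L, hL, rfl⟩

/-- Size of the weakening block. [folklore] -/
theorem proofSize_weakLines (K A : PropForm ℕ) (Ls : List (PropForm ℕ)) :
    proofSize (weakLines K A Ls) = (Ls.map fun L => K.size + A.size + L.size + 2).sum := by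
  induction Ls with
  | nil => rfl
  | cons L Ls ih =>
    simp only [weakLines, List.map_cons, Scaffold.proofSize_cons, List.sum_cons] at ih ⊢
    rw [ih]
    simp [ctx, size]
    ring

/-! ### Case analysis -/

/-- The case hypotheses are inferable from nothing: `(K ∨ ¬A) ∨ A` and `(K ∨ A) ∨ ¬A`.
[cite: CookReckhow1979, §2] -/
theorem isInferredFrom_caseT (hG : ∀ r ∈ rules, r ∈ G.rules) (K A : PropForm ℕ) {S : Set (PropForm ℕ)} :
    G.IsInferredFrom S (ctx (disj K (neg A)) A) :=
  infer hG 1 (by decide) (FregeSystem.sub [K, A]) rfl FregeSystem.prems_nil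

/-- The negative case hypothesis `(K ∨ A) ∨ ¬A`. [cite: CookReckhow1979, §2] -/
theorem isInferredFrom_caseF (hG : ∀ r ∈ rules, r ∈ G.rules) (K A : PropForm ℕ) {S : Set (PropForm ℕ)} :
    G.IsInferredFrom S (ctx (disj K A) (neg A)) :=
  infer hG 2 (by decide) (FregeSystem.sub [K, A]) rfl FregeSystem.prems_nil

/-- The merged lines `K ∨ L`, `L ∈ Ls`. [folklore] -/
def mergeLines (K : PropForm ℕ) (Ls : List (PropForm ℕ)) : List (PropForm ℕ) := Ls.map (ctx K)

/-- **The case-split combinator.** If a block `D₁` (under the hypothesis `A`: context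
`K ∨ ¬A`) and then a block `D₂` (under `¬A`: context `K ∨ A`) make the lines `(K ∨ ¬A) ∨ L`
and `(K ∨ A) ∨ L` available for every `L ∈ Ls`, then appending the merged lines `K ∨ L` gives
a block. [cite: CookReckhow1979, §2] -/
theorem isBlock_cases (hG : ∀ r ∈ rules, r ∈ G.rules) {K A : PropForm ℕ} {Ls D₁ D₂ : List (PropForm ℕ)}
    (h₁ : G.IsBlock Γ D₁) (h₂ : G.IsBlock (Γ ∪ {χ | χ ∈ D₁}) D₂)
    (hT : ∀ L ∈ Ls, ctx (disj K (neg A)) L ∈ Γ ∪ {χ | χ ∈ D₁} ∪ {χ | χ ∈ D₂})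
    (hF : ∀ L ∈ Ls, ctx (disj K A) L ∈ Γ ∪ {χ | χ ∈ D₁} ∪ {χ | χ ∈ D₂}) :
    G.IsBlock Γ (D₁ ++ D₂ ++ mergeLines K Ls) := by
  refine (h₁.append h₂).append (Scaffold.isBlock_of_forall fun θ hθ => ?_)
  obtain ⟨L, hL, rfl⟩ := List.mem_map.1 hθ
  have hset : Γ ∪ {χ | χ ∈ D₁ ++ D₂} = Γ ∪ {χ | χ ∈ D₁} ∪ {χ | χ ∈ D₂} := by
    ext χ; simp [or_assoc]
  rw [hset]
  exact Or.inr (infer hG 3 (by decide) (FregeSystem.sub [K, A, L]) rfl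
    (FregeSystem.prems_cons (hT L hL) (FregeSystem.prems_cons (hF L hL) FregeSystem.prems_nil)))

/-- The merged line of a listed `L`. [folklore] -/
theorem mem_mergeLines {K L : PropForm ℕ} {Ls : List (PropForm ℕ)} (hL : L ∈ Ls) : ctx K L ∈ mergeLines K Ls :=
  List.mem_map.2 ⟨L, hL, rfl⟩

/-- Size of the merged lines. [folklore] -/
theorem proofSize_mergeLines (K : PropForm ℕ) (Ls : List (PropForm ℕ)) :
    proofSize (mergeLines K Ls) = (Ls.map fun L => K.size + L.size + 1).sum := by
  induction Ls with
  | nil => rfl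
  | cons L Ls ih =>
    simp only [mergeLines, List.map_cons, Scaffold.proofSize_cons, List.sum_cons] at ih ⊢
    rw [ih]
    simp [ctx, size]

end Logic

end Literature.Computability.MetaComplexity
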